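import Summits.ResolutionOfSingularities.ResolutionOfSingularities.Theorems.WeightedInvariantHypersurfaceCentreAssemblyPlusStalk
import Summits.ResolutionOfSingularities.ResolutionOfSingularities.Theorems.WeightedInvariantHypersurfaceCentreAssemblyExcDrop
import Summits.ResolutionOfSingularities.ResolutionOfSingularities.Theorems.WeightedInvariantHypersurfaceCentreAssemblyTorusHalf
import Summits.ResolutionOfSingularities.ResolutionOfSingularities.Theorems.WeightedInvariantHypersurfaceCentreAssemblyIotaMaxPos
import Summits.ResolutionOfSingularities.ResolutionOfSingularities.Theorems.WeightedInvariantHypersurfaceCentreAssemblyStubRegular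
import Summits.ResolutionOfSingularities.ResolutionOfSingularities.Theorems.WeightedInvariantWeightedThesisGlobalCobordantPlus
import Summits.ResolutionOfSingularities.ResolutionOfSingularities.Theorems.WeightedInvariantWeightedThesisHypersurfaceStrategy
import HarnessLib

/-!
# Door assembly H2c″ — sub-stub [S6] `stub_iotaMax_lt_of_step` BY NAME: the maximum of `ι` drops along a step of the
# cobordant tower of the canonical centre

Route `ResolutionOfSingularities/WeightedInvariant`, crux `Theses.WeightedInvariant.HypersurfaceCentreConstruction`
(stmt-ResolutionOfSingularities-19897), door line `local-engine`, skeleton v3.4–v3.6 (`door_local_engine_v34.lean`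
39ae94b0a0c6361e…, res-L1-w43-plan-1; LINE tier byte-identical since), stub [S6] (holder res-L1-w43-stub-9 = res-D-brk-1),
signature VERBATIM as registered (`p`, `ι`, `J` section variables; `hopen` after `hgame`, typing point [S6]-c).

COMPOSITION (plan of record `S6-PLAN.md`): for a step `P' → P` of the tower of the centre rule `c` (a singular pair
`P = (Y, X)`, `R'` a Rees filtration with the pieces of the canonical centre `R = c f X`, `P' = (B₊, σˢ(X)|_{B₊})`):
* `0 < iotaMax ι X` (res-type-057, `iotaMax_pos`, p509643);
* `B = Spec_Y ⊕ 𝒥ₙ tⁿ` is locally Noetherian: `R` is a regular weighted centre ([S4] BY NAME,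
  `stub_isRegularWeightedCentre_of_isCanonicalCentre`, p506882 — this is where `hopen` is consumed) and
  `GlobalCobordantPlus.locallyOfFiniteType_π`;
* aggregation `iotaMax_lt_iotaMax_of_forall_iotaAt_lt` (res-type-057, p504597) reduces the claim to the pointwise bound
  `iotaAt ι X' y' < iotaMax ι X` on the non-regular locus of `X' = σˢ(X)|_{B₊}`;
* pointwise: a principal affine chart `(U, F)` of `X` at the base point `y = σ₊(y')`, the chart `φ_U` of `B₊` over `U` with
  `y' = φ_U x` and the K4-E stalk chain `Ψ₀ : 𝒪_{B₊,y'} ≃+* (⊕ₙ 𝒥ₙ(U) tⁿ)_q` carrying `σˢ(X)_{y'}` onto the `t⁻¹`-saturation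
  of `X(U)` (res-type-089 / res-type-057 / stub-9, `…CentreAssemblyPlusStalk`); then the EXCEPTIONAL HALF over the maximum
  locus (stub-9, `iotaAt_lt_iotaMax_of_mem_maxLocus_of_stalkIso`, `…CentreAssemblyExcDrop`: the (drop) clause of the
  canonical game through res-type-048's bridge and factorisation) and the TORUS HALF off it (res-type-057,
  `iotaAt_lt_iotaMax_of_not_mem_maxLocus_of_stalkChain`, `…CentreAssemblyTorusHalf`: (c10) and the `𝔪²` reflection of the
  unit chart).
The clauses `hc7` and `hJs` of the registered shape are consumed by `iotaMax_pos` resp. idle.  OURS; AI-written, weaker than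
expert review; no claim about Hironaka's problem. [cite: Wlodarczyk2022, Thm. 4.3.1 and 3.3.12]
-/

noncomputable section

set_option linter.dupNamespace false -- mandated namespace of this single-conjunct summit

open CategoryTheory AlgebraicGeometry TopologicalSpace IsLocalRing
open Literature.AlgebraicGeometry.Resolution
open Summit.ResolutionOfSingularities.ResolutionOfSingularities.Theorems

namespace Summit.ResolutionOfSingularities.ResolutionOfSingularities.Cruxes.HypersurfaceCentreConstruction.LocalEngine

variable {p : ℕ} (ι : (R : Type) → [CommRing R] → R → Ordinal.{0})
  (J : (R : Type) → [CommRing R] → R → ℕ → Ideal R)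

/-- Two-step extension followed by a saturation equals the one-step extension's saturation, along a factorisation of
the structure maps (used to pass the K4-E chain to the torus half, which reads `K(U)` extended in one step). [folklore] -/
theorem iSup_colon_map_map_eq_of_comp_eq {A S L : Type*} [CommSemiring A] [CommSemiring S] [CommSemiring L]
    [Algebra A S] [Algebra S L] [Algebra A L] (h : (algebraMap S L).comp (algebraMap A S) = algebraMap A L)
    (I : Ideal A) (t : L) :
    (⨆ n : ℕ, ((I.map (algebraMap A S)).map (algebraMap S L)).colon {t ^ n}) =
      ⨆ n : ℕ, (I.map (algebraMap A L)).colon {t ^ n} := by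
  rw [Ideal.map_map, h]

/-- **The pointwise bound on one step of the tower**: at every point `y'` of the non-regular locus of the strict transform
`σˢ(X)|_{B₊}` of a singular hypersurface pair along a cobordant blow-up of its CANONICAL centre, `ι` is strictly below the
maximum of `ι` on `(Y, X)` — exceptional half over the maximum locus, torus half off it, both read through the K4-E stalk
chain of the chart of `B₊` over a principal affine chart of `X` at the base point. [cite: Wlodarczyk2022, Thm. 4.3.1] -/
theorem iotaAt_strictTransformPlus_lt_iotaMax (hc6 : IotaIsoInvariant ι) (hc10 : IotaTorusFactorMonotone ι)
    (hu : IotaUnitInvariant ι) (hJ : JIsoInvariant J) (hJu : JUnitInvariant J) (hgame : CanonicalGameClause p ι J)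
    {k : Type} [Field k] [CharP k p] [PerfectField k] {Y : Scheme.{0}} (f : Y ⟶ Spec (.of k)) [Smooth f]
    (X : Y.IdealSheafData) (hX : IsLocallyPrincipal X) (R : ReesAlgebraData Y) (hR : IsCanonicalCentre ι J X R)
    (R' : ReesFiltration Y) (hR' : R'.ideal = R.piece) [IsLocallyNoetherian R'.cobordantBlowup]
    [Smooth (R'.πPlus ≫ f)] (hlp : IsLocallyPrincipal (R'.strictTransformPlus X))
    (y' : (R'.plus : Scheme.{0})) (hy' : y' ∈ singImage (R'.strictTransformPlus X)) :
    iotaAt ι (R'.strictTransformPlus X) y' < iotaMax ι X := by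
  haveI : IsRegularLocalRing ((R'.plus : Scheme.{0}).presheaf.stalk y') :=
    isRegularLocalRing_stalk_of_smooth_of_field (R'.πPlus ≫ f) y'
  have hX' : ∃ g, stalkIdeal (R'.strictTransformPlus X) y' = Ideal.span {g} :=
    ⟨_, stalkIdeal_eq_span_localGenerator_of_isLocallyPrincipal _ hlp y'⟩
  -- a principal affine chart of `X` at the base point, and the chart of `B₊` over it through `y'`
  obtain ⟨U, hyU, F, hF⟩ := hX (R'.πPlus y')
  obtain ⟨φ, hφo, hφ⟩ := exists_plusChartFac R' U
  haveI := hφo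
  obtain ⟨x, rfl⟩ := exists_plusChartFac_apply_eq R' U φ hφ y' hyU
  -- the K4-E stalk chain at `φ x`
  obtain ⟨Ψ₀, hΨ₀⟩ := exists_stalk_ringEquiv_of_plusChartFac R' U φ hφ x _ rfl
  have hII := (primeIdealOf_πPlus_plusChartFac_asIdeal R' U φ hφ x _ rfl).symm
  by_cases hyM : R'.πPlus (φ x) ∈ maxLocus ι X
  · -- exceptional half
    exact iotaAt_lt_iotaMax_of_mem_maxLocus_of_stalkIso ι J hc6 hu hJ hJu hgame f X R hR R' hR' U
      (πPlus_plusChartFac_mem R' U φ hφ x) hyM hF (R'.strictTransformPlus X) (φ x) hX' hy' _ Ψ₀ (hΨ₀ X) hII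
      (not_irrelevant_le_of_plusChart R' U x _ rfl)
  · -- torus half
    have hcomp : (algebraMap (R'.sectionsRing U) (Localization.AtPrime ((R'.plusChart U).ι x).asIdeal)).comp
        (algebraMap Γ(Y, U) (R'.sectionsRing U)) =
        algebraMap Γ(Y, U) (Localization.AtPrime ((R'.plusChart U).ι x).asIdeal) :=
      RingHom.ext fun _ => rfl
    have hI := (hΨ₀ X).trans (iSup_colon_map_map_eq_of_comp_eq hcomp (X.ideal U) _)
    exact iotaAt_lt_iotaMax_of_not_mem_maxLocus_of_stalkChain ι J hc6 hc10 hu f X hX hR U (R'.filtration U)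
      (fun n => by rw [ReesFiltration.filtration_ideal, hR']) (R'.πPlus (φ x)) (πPlus_plusChartFac_mem R' U φ hφ x) hyM
      (R'.strictTransformPlus X) hlp (φ x) _ Ψ₀ hI hII hy'

/-- **[S6] of the door skeleton, BY NAME: the maximum of `ι` drops along a step of the cobordant tower of the canonical
centre.**  For `ι`, `J` carrying the clauses (c6), (c7), (c8), (c10), (c12a), `J` iso/unit-invariance, (c11), the canonical
game clause (c9′) and the stratum-exact open presentation (open″), a perfect field `k` of characteristic `p`, a centre
rule `c` that is canonical on singular hypersurface pairs, and a step `P' → P` of its tower: `iotaMax ι P'.X < iotaMax ι P.X`.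
[cite: Wlodarczyk2022, Thm. 4.3.1] -/
theorem stub_iotaMax_lt_of_step (hc6 : IotaIsoInvariant ι) (hc7 : IotaGenerizationMonotone ι)
    (hc8 : IotaUpperSemicontinuous ι) (hc10 : IotaTorusFactorMonotone ι) (hu : IotaUnitInvariant ι) (hJ : JIsoInvariant J) (hJu : JUnitInvariant J)
    (hJs : IotaJEssSmoothCompatible ι J) (hgame : CanonicalGameClause p ι J)
    (hopen : JOpenPresentationForallSing p ι J)
    {k : Type} [Field k] [CharP k p] [PerfectField k]
    (c : ∀ ⦃Y : Scheme.{0}⦄, (Y ⟶ Spec (.of k)) → Y.IdealSheafData → ReesAlgebraData Y)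
    (hc : ∀ ⦃Y : Scheme.{0}⦄ (f : Y ⟶ Spec (.of k)) [Smooth f] [IsSeparated f] [QuasiCompact f]
      (X : Y.IdealSheafData), IsLocallyPrincipal X → IsIntegral X.subscheme → ¬ Scheme.IsRegular X.subscheme →
      IsCanonicalCentre ι J X (c f X))
    (P' P : HypersurfacePair k) (h : HypersurfacePair.Step c P' P) : iotaMax ι P'.X < iotaMax ι P.X := by
  have _unused : IotaJEssSmoothCompatible ι J := hJs
  obtain ⟨hsing, R', hR', hs, hsep, hqc, hlp, hint, rfl⟩ := h
  show iotaMax ι (R'.strictTransformPlus P.X) < iotaMax ι P.X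
  have hR : IsCanonicalCentre ι J P.X (c P.f P.X) := hc P.f P.X P.isLocallyPrincipal P.isIntegral hsing
  -- `0 < ι_max` on the singular pair
  haveI := P.isIntegral
  have hM : 0 < iotaMax ι P.X := iotaMax_pos ι J hc6 hu hc7 hgame P.f P.X P.isLocallyPrincipal hsing
  -- `B` is locally Noetherian: the canonical centre is a regular weighted centre ([S4] by name)
  haveI : IsLocallyNoetherian P.Y := LocallyOfFiniteType.isLocallyNoetherian P.f
  have hRW : (c P.f P.X).IsRegularWeightedCentre :=
    stub_isRegularWeightedCentre_of_isCanonicalCentre ι J hc6 hc8 hu hJ hJu hgame hopen P.f P.X P.isLocallyPrincipal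
      P.isIntegral hsing _ hR
  haveI : LocallyOfFiniteType R'.π :=
    WeightedThesis.GlobalCobordantPlus.locallyOfFiniteType_π (c P.f P.X) R' hR' hRW
  haveI : IsLocallyNoetherian R'.cobordantBlowup := LocallyOfFiniteType.isLocallyNoetherian R'.π
  haveI : Smooth (R'.πPlus ≫ P.f) := hs
  haveI : QuasiCompact (R'.πPlus ≫ P.f) := hqc
  -- aggregation over the non-regular locus of the strict transform
  exact iotaMax_lt_iotaMax_of_forall_iotaAt_lt ι hc6 hc8 hu (R'.πPlus ≫ P.f) P.X (R'.strictTransformPlus P.X) hlp hM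
    fun y' hy' => iotaAt_strictTransformPlus_lt_iotaMax ι J hc6 hc10 hu hJ hJu hgame P.f P.X P.isLocallyPrincipal _ hR R'
      hR' hlp y' hy'

end Summit.ResolutionOfSingularities.ResolutionOfSingularities.Cruxes.HypersurfaceCentreConstruction.LocalEngine

end
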